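import Mathlib
import Summits.Ventures.PercRepro2.Defs
import Summits.Ventures.PercRepro2.Graph
import Summits.Ventures.PercRepro2.OneColourSwitch

/-!
# Connections through a cut vertex (blind cell PercRepro2, p3 g16, 2026-08-27;
`proofs/P3-CPNC.md` §13)

A vertex `v` is a CUT VERTEX between the vertex sets `L` (left) and `Rt` (right) when every edge
lies on one side: `side e = true` means both endpoints of `e` are in `L ∪ {v}`, `side e = false`
both in `Rt ∪ {v}` (`CutVertex`).  Then (closure lemma `mem_of_conn_of_closed`):
two left vertices are joined iff they are joined by left edges (`conn_iff_restrict_left`), a left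
and a right vertex are joined iff both are joined to `v` (`conn_cross_iff`), and a connection
between left vertices only reads the left edges (`conn_left_congr`).  The graph-theoretic half of
the cut-vertex product formula for the move `m9` (`CutVertexM9.lean`).  Own work; std axioms.
-/

namespace Summit.Ventures.PercRepro2

namespace CutVertexM9

open Finset Classical

variable {V : Type*} {E : Type*}

/-- A cut vertex `v` separating the vertex set `L` (left) from `Rt` (right): every edge of side
`true` has both endpoints in `L ∪ {v}`, every edge of side `false` both endpoints in `Rt ∪ {v}`,
the two sides are disjoint and `v` lies in neither. -/
structure CutVertex (ends : E → Sym2 V) (side : E → Bool) (L : Set V) (v : V) (Rt : Set V) :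
    Prop where
  /-- left edges live on `L ∪ {v}` -/
  left : ∀ e, side e = true → ∀ x ∈ ends e, x ∈ L ∨ x = v
  /-- right edges live on `Rt ∪ {v}` -/
  right : ∀ e, side e = false → ∀ x ∈ ends e, x ∈ Rt ∨ x = v
  /-- the sides are disjoint -/
  disj : ∀ x, x ∈ L → x ∈ Rt → False
  /-- `v` is not on the left -/
  vL : v ∉ L
  /-- `v` is not on the right -/
  vR : v ∉ Rt

/-- The mirror image of a cut-vertex structure: sides swapped. -/
lemma CutVertex.symm {ends : E → Sym2 V} {side : E → Bool} {L : Set V} {v : V} {Rt : Set V}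
    (h : CutVertex ends side L v Rt) : CutVertex ends (fun e => !side e) Rt v L where
  left := fun e he x hx => h.right e (by simpa using he) x hx
  right := fun e he x hx => h.left e (by simpa using he) x hx
  disj := fun x hx hx' => h.disj x hx' hx
  vL := h.vR
  vR := h.vL

/-- The configuration restricted to the edges of side `b` (the other side closed). -/
def restrict (side : E → Bool) (b : Bool) (ω : Config E) : Config E :=
  fun e => if side e = b then ω e else false

/-- The restriction is below the configuration. -/
lemma restrict_le (side : E → Bool) (b : Bool) (ω : Config E) : restrict side b ω ≤ ω := by
  intro e
  simp only [restrict]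
  split_ifs
  · exact le_rfl
  · exact Bool.false_le _

/-- The restriction to side `false` is the restriction to side `true` of the swapped sides. -/
lemma restrict_false_eq (side : E → Bool) (ω : Config E) :
    restrict side false ω = restrict (fun e => !side e) true ω := by
  funext e
  simp only [restrict]
  rcases Bool.eq_false_or_eq_true (side e) with hs | hs <;> simp [hs]

/-- Configurations agreeing on side `b` have the same restriction to side `b`. -/
lemma restrict_eq_of_agree {side : E → Bool} {b : Bool} {ω ω' : Config E}
    (hag : ∀ e, side e = b → ω e = ω' e) : restrict side b ω = restrict side b ω' := by
  funext e
  simp only [restrict]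
  split_ifs with hs
  · exact hag e hs
  · rfl

section PathLemma

variable {ends : E → Sym2 V} {side : E → Bool} {L : Set V} {v : V} {Rt : Set V}

/-- **Path lemma.** Starting from `p ∈ L ∪ {v}`, every vertex `x` reached by open edges is reached
inside the left side if `x ∈ L ∪ {v}`, and through `v` (left to `v`, then right) if
`x ∈ Rt ∪ {v}`. -/
theorem conn_cutVertex (h : CutVertex ends side L v Rt) {p x : V} (hp : p ∈ L ∨ p = v)
    {ω : Config E} (hc : Conn ends ω p x) :
    ((x ∈ L ∨ x = v) → Conn ends (restrict side true ω) p x) ∧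
      ((x ∈ Rt ∨ x = v) →
        Conn ends (restrict side true ω) p v ∧ Conn ends (restrict side false ω) v x) := by
  have key : x ∈ {y | ((y ∈ L ∨ y = v) → Conn ends (restrict side true ω) p y) ∧
      ((y ∈ Rt ∨ y = v) →
        Conn ends (restrict side true ω) p v ∧ Conn ends (restrict side false ω) v y)} := by
    refine mem_of_conn_of_closed (ends := ends) (ω := ω) ?_ ?_ hc
    · rintro y ⟨hyL, hyR⟩ z hyz
      obtain ⟨_, e, he, hends⟩ := openGraph_adj.1 hyz
      cases hside : side e with
      | true =>
        have hy : y ∈ L ∨ y = v :=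
          h.left e hside y (by rw [hends]; exact Sym2.mem_mk_left y z)
        have hz : z ∈ L ∨ z = v :=
          h.left e hside z (by rw [hends]; exact Sym2.mem_mk_right y z)
        have hpy := hyL hy
        have he' : restrict side true ω e = true := by simp [restrict, hside, he]
        have hpz : Conn ends (restrict side true ω) p z :=
          conn_trans hpy (conn_of_openAdj ⟨e, he', hends⟩)
        refine ⟨fun _ => hpz, fun hz' => ?_⟩
        have hzv : z = v := by
          rcases hz with hz | hz
          · rcases hz' with hz' | hz'
            · exact (h.disj z hz hz').elim
            · exact hz'
          · exact hz
        refine ⟨?_, ?_⟩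
        · rw [← hzv]; exact hpz
        · rw [hzv]; exact conn_refl _ _ _
      | false =>
        have hy : y ∈ Rt ∨ y = v :=
          h.right e hside y (by rw [hends]; exact Sym2.mem_mk_left y z)
        have hz : z ∈ Rt ∨ z = v :=
          h.right e hside z (by rw [hends]; exact Sym2.mem_mk_right y z)
        obtain ⟨hpv, hvy⟩ := hyR hy
        have he' : restrict side false ω e = true := by simp [restrict, hside, he]
        have hvz : Conn ends (restrict side false ω) v z :=
          conn_trans hvy (conn_of_openAdj ⟨e, he', hends⟩)
        refine ⟨fun hz' => ?_, fun _ => ⟨hpv, hvz⟩⟩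
        have hzv : z = v := by
          rcases hz with hz | hz
          · rcases hz' with hz' | hz'
            · exact (h.disj z hz' hz).elim
            · exact hz'
          · exact hz
        rw [hzv]; exact hpv
    · refine ⟨fun _ => conn_refl _ _ _, fun hp' => ?_⟩
      have hpv : p = v := by
        rcases hp with hp | hp
        · rcases hp' with hp' | hp'
          · exact (h.disj p hp hp').elim
          · exact hp'
        · exact hp
      rw [hpv]
      exact ⟨conn_refl _ _ _, conn_refl _ _ _⟩
  exact key

/-- Two left vertices are joined iff they are joined by left edges. -/
theorem conn_iff_restrict_left (h : CutVertex ends side L v Rt) {p q : V} (hp : p ∈ L ∨ p = v)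
    (hq : q ∈ L ∨ q = v) (ω : Config E) :
    Conn ends ω p q ↔ Conn ends (restrict side true ω) p q :=
  ⟨fun hc => (conn_cutVertex h hp hc).1 hq, fun hc => conn_mono (restrict_le side true ω) hc⟩

/-- Two right vertices are joined iff they are joined by right edges. -/
theorem conn_iff_restrict_right (h : CutVertex ends side L v Rt) {p q : V} (hp : p ∈ Rt ∨ p = v)
    (hq : q ∈ Rt ∨ q = v) (ω : Config E) :
    Conn ends ω p q ↔ Conn ends (restrict side false ω) p q := by
  rw [restrict_false_eq]
  exact conn_iff_restrict_left h.symm hp hq ω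

/-- A left vertex and a right vertex are joined iff both are joined to the cut vertex. -/
theorem conn_cross_iff (h : CutVertex ends side L v Rt) {p r : V} (hp : p ∈ L ∨ p = v)
    (hr : r ∈ Rt ∨ r = v) (ω : Config E) :
    Conn ends ω p r ↔ Conn ends ω p v ∧ Conn ends ω r v := by
  constructor
  · intro hc
    obtain ⟨h1, h2⟩ := (conn_cutVertex h hp hc).2 hr
    exact ⟨conn_mono (restrict_le side true ω) h1,
      conn_symm (conn_mono (restrict_le side false ω) h2)⟩
  · rintro ⟨h1, h2⟩
    exact conn_trans h1 (conn_symm h2)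

/-- Connections between left vertices only read the left edges. -/
theorem conn_left_congr (h : CutVertex ends side L v Rt) {p q : V} (hp : p ∈ L ∨ p = v)
    (hq : q ∈ L ∨ q = v) {ω ω' : Config E} (hag : ∀ e, side e = true → ω e = ω' e) :
    Conn ends ω p q ↔ Conn ends ω' p q := by
  rw [conn_iff_restrict_left h hp hq ω, conn_iff_restrict_left h hp hq ω', restrict_eq_of_agree hag]

/-- Connections between right vertices only read the right edges. -/
theorem conn_right_congr (h : CutVertex ends side L v Rt) {p q : V} (hp : p ∈ Rt ∨ p = v)
    (hq : q ∈ Rt ∨ q = v) {ω ω' : Config E} (hag : ∀ e, side e = false → ω e = ω' e) :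
    Conn ends ω p q ↔ Conn ends ω' p q := by
  rw [conn_iff_restrict_right h hp hq ω, conn_iff_restrict_right h hp hq ω', restrict_eq_of_agree hag]

/-- Agreement on a side passes to the complements. -/
lemma compl_agree {side : E → Bool} {b : Bool} {ω ω' : Config E}
    (hag : ∀ e, side e = b → ω e = ω' e) :
    ∀ e, side e = b → OneColourSwitch.compl ω e = OneColourSwitch.compl ω' e :=
  fun e he => by simp [OneColourSwitch.compl, hag e he]

end PathLemma

end CutVertexM9

end Summit.Ventures.PercRepro2
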